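import Summits.ABC.IUTFork.Joshi.ArithTeichmullerFrobeniusScalar
import Summits.ABC.IUTFork.Joshi.ATS1SpacesStructureBridge
import HarnessLib

/-!
# Joshi, *Arithmetic Teichmüller spaces I* (arXiv 2106.11452v4) Thm 5.20.1: the clause «`G_E ↷ |𝒴_{F,E}|`» under the UNITS
# READING named by print's proof (`G_E → 𝒪_E^*` → Lubin–Tate unit scalars on `𝒢(𝒪_F)`), at the CONSTRUCTED topology — the action is
# TRIVIAL on (5.20.2), so the `G_E`-compatibility clause of Thm 5.20.1 is IDLE under that reading (located; no test line vs `S`)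

Companion of the abc-iut cell, branch E (seat abc-iut-E-t1 gen 5, [J-I] carrier owner; rung LADDER-ABC:A2.E), authors-first on this
seat's BUILT parents `ArithTeichmullerAction` (p429850: `UntiltPoints`, `ptEquiv` = (5.20.2), `projAct`), `ArithTeichmullerFrobeniusScalar`
(p443500: `projAct_smulOfUnit`, `projActPerm`, the constructed topology `UntiltPoints.ptTopology`) and E-t21's `ATS1SpacesStructureBridge`
(p433841: the signature `ATS1.PointsTopGal E D` = «a topology on `|𝒴_{F,E}|` + an action `G_E ↷ |𝒴_{F,E}|` commuting with `φ`» and the claim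
shell `ATS1.Thm5201Full`), all BY NAME, nothing restated. It closes the one residue recorded by this lineage (HOME/HANDOFF.md 12:06:42Z /
12:43:18Z: «a `G_E`-action on `|𝒴_{F,E}|` is not typed») and supplies the tie E-t21 asked for (STATUS 12:17:13Z: «`PointsTopGal` ↔ p443500»).
TAKES NO SIDE on [IUTchIII] Cor. 3.12 or on any author (Mochizuki / Scholze–Stix / Joshi / Dupuy–Hilado); typed ≠ proved ≠ endorsed;
a reading exhibits ONE way of making print's words precise, nothing more; no test line vs `S` arises here.

Source (UNREFEREED «Preliminary version for comments»; bib `Joshi2021ATS1`; render of record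
`HOME/plan/repair/lit/renders/Joshi-ATS1-2106.11452v4-PDFpaged-book-anonnd/`, «p.N l.M»): Thm 5.20.1, p.33 l.34–39 «any anabelomorphism
`α : G_E → G_{E′}` induces a homeomorphism of topological spaces compatible with the respective topological group actions
`G_E ↷ |𝒴_{F,E}| ≃ |𝒴_{F,E′}| ↶ G_{E′}`»; its PROOF, p.33 last line – p.34 l.6: «(5.20.2) `|𝒴_{F,E}| = (𝒢(𝒪_F) − {0})/𝒪_E^*` … The
topological space `(𝒢(𝒪_F) − {0})` is independent of `E, E′` and the anabelomorphism `α : G_E → G_{E′}` induces isomorphisms of the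
topological groups `𝒪_E^* ≃ 𝒪_{E′}^*` and `E^* ≃ E′^*`. Hence all the assertions are immediate.» Print does not say through WHICH map
`G_E` acts on `|𝒴_{F,E}|`; the only groups its proof names are `𝒪_E^*` and `E^* = π^ℤ·𝒪_E^*` (and `π^ℤ ↔ φ^ℤ` is the step to `|𝒳_{F,E}|`,
p443500 `FrobScalarDatum`). The UNITS READING typed here: `G_E` acts through SOME homomorphism `χ : G_E → 𝒪_E^*` (e.g. a Lubin–Tate /
reciprocity character — not constructed, ANY `χ` is allowed) followed by the `𝒪_E`-module action of units on `𝒢(𝒪_F)`.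
[claim: Joshi2021ATS1, status: disputed]

WHAT IS TYPED / PROVED (sorry-free, standard axioms; every hypothesis is a parameter, nothing asserted).
* §1 `UntiltPoints.unitsPerm D u` — a unit `u ∈ 𝒪_E^*` acting on `|𝒴_{F,E}|` by transport of `u • (·)` along (5.20.2); KERNEL DATUM
  `unitsPerm_apply_eq : unitsPerm D u y = y` (from p443500 `projAct_smulOfUnit`), `unitsPerm_eq_one`; the homomorphism `unitsPermHom`;
  the units reading `unitsAct D χ : Γ →* Perm |𝒴_{F,E}|` of an action of ANY group `Γ` through `χ : Γ →* 𝒪_E^*`, with `unitsAct_apply`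
  (every element fixes every point), `unitsAct_eq_one`, `unitsAct_frob` / `unitsAct_ptAct` (commutes with `φ` and with every
  `σ ∈ Aut_{𝒪_E}(𝒢(𝒪_F))`), `continuous_unitsAct` (for the constructed topology).
* §2 `UntiltPoints.pointsTopGalOfUnits D E χ : ATS1.PointsTopGal E D` — E-t21's signature INSTANTIATED at the constructed topology
  `ptTopology` with the units reading of `G_E = E.fixingSubgroup`; `nonempty_pointsTopGal` (the signature is inhabited over EVERY `D`).
* §3 LOCATED: `ATS1.thm5201Full_units_iff` — under units readings on both sides, `Thm5201Full E E′ T T′` is EQUIVALENT to the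
  Galois-free sentence «if `G_E ≃ G_{E′}` topologically, there is a Frobenius-compatible homeomorphism `|𝒴_{F,E}| ≃ₜ |𝒴_{F,E′}|`
  (constructed topologies)»: the equivariance clause carries no content under this reading; `thm5201Full_units_indep` (truth value
  independent of `χ, χ′`), `thm5201Full_units_of_frobHomeomorph`, `thm5201Full_units_self` (the reflexive case holds: non-vacuity of
  the claim's shape), `thm5201_of_units` (E-t21's weak shell `Thm5201` recovered by name).
Deliberately NOT here: a construction of `χ` (no local class field theory used); any OTHER reading of «`G_E ↷ |𝒴_{F,E}|`» (e.g. via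
`𝒴_{F,E} ⊗_E Ē` — no Fargues–Fontaine curve in the tree); whether print intends the units reading is NOT adjudicated here.
-/

noncomputable section

namespace Summit.ABC.IUTFork.Joshi

variable {p : ℕ} [Fact p.Prime]

/-! ## 1. Unit scalars on `|𝒴_{F,E}|` and the units reading of a group action -/

namespace UntiltPoints

variable {𝒪E : Type} [CommRing 𝒪E] (D : UntiltPoints p 𝒪E)

/-- A unit `u ∈ 𝒪_E^*` acting on `|𝒴_{F,E}|`: the `𝒪_E`-linear automorphism `u • (·)` of `𝒢(𝒪_F)` on `(𝒢(𝒪_F) − {0})/𝒪_E^*`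
(p443500 `projActPerm`), transported along (5.20.2) = `ptEquiv` (the «`𝒪_E^*`» of print's proof, p.34 l.4). No continuity of the
scalar action is needed or assumed. [claim: Joshi2021ATS1, status: disputed] -/
def unitsPerm (u : 𝒪Eˣ) : Equiv.Perm D.Pt :=
  D.ptEquiv.trans ((projActPerm (LinearEquiv.smulOfUnit u)).trans D.ptEquiv.symm)

/-- Unfolding: `unitsPerm D u y = ptEquiv⁻¹ (projAct (u • ·) (ptEquiv y))`. [folklore] -/
theorem unitsPerm_apply (u : 𝒪Eˣ) (y : D.Pt) :
    D.unitsPerm u y = D.ptEquiv.symm (projAct (LinearEquiv.smulOfUnit u) (D.ptEquiv y)) := rfl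

/-- **KERNEL DATUM: every unit scalar fixes every point of `|𝒴_{F,E}|`** (`⟦u • g⟧ = ⟦g⟧` on (5.20.2); p443500 `projAct_smulOfUnit`).
Recorded without interpretation. [folklore] -/
theorem unitsPerm_apply_eq (u : 𝒪Eˣ) (y : D.Pt) : D.unitsPerm u y = y := by
  rw [unitsPerm_apply, projAct_smulOfUnit, Equiv.symm_apply_apply]

/-- Every unit acts as the identity permutation of `|𝒴_{F,E}|`. [folklore] -/
theorem unitsPerm_eq_one (u : 𝒪Eˣ) : D.unitsPerm u = 1 := Equiv.ext (D.unitsPerm_apply_eq u)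

/-- The action of `𝒪_E^*` on `|𝒴_{F,E}|` as a homomorphism `𝒪_E^* →* Perm |𝒴_{F,E}|` (trivial, by `unitsPerm_eq_one`). [folklore] -/
def unitsPermHom : 𝒪Eˣ →* Equiv.Perm D.Pt where
  toFun := D.unitsPerm
  map_one' := D.unitsPerm_eq_one 1
  map_mul' u v := by rw [D.unitsPerm_eq_one, D.unitsPerm_eq_one, D.unitsPerm_eq_one, mul_one]

/-- `unitsPermHom D u = unitsPerm D u`. [folklore] -/
@[simp] theorem unitsPermHom_apply (u : 𝒪Eˣ) : D.unitsPermHom u = D.unitsPerm u := rfl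

/-- **UNITS READING of «`Γ ↷ |𝒴_{F,E}|`»** for a group `Γ` (in print `Γ = G_E`, Thm 5.20.1, p.33 l.36–37) acting THROUGH a homomorphism
`χ : Γ → 𝒪_E^*` (a Lubin–Tate / reciprocity character in the intended case — NOT constructed here; any `χ`) and the unit scalars on
`𝒢(𝒪_F)`: the only subgroup of `E^*` that print's proof (p.34 l.4–5) names besides `π^ℤ ↔ φ^ℤ`. A READING, one way of making the
clause precise over the signature; never asserted to be print's intention. [claim: Joshi2021ATS1, status: disputed] -/
@[claim "Joshi2021ATS1" "disputed"]
def unitsAct {Γ : Type} [Group Γ] (χ : Γ →* 𝒪Eˣ) : Γ →* Equiv.Perm D.Pt := D.unitsPermHom.comp χ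

variable {Γ : Type} [Group Γ] (χ : Γ →* 𝒪Eˣ)

/-- **Under the units reading every `g ∈ Γ` fixes every point of `|𝒴_{F,E}|`.** DERIVED (kernel datum `unitsPerm_apply_eq`). [folklore] -/
theorem unitsAct_apply (g : Γ) (y : D.Pt) : D.unitsAct χ g y = y := D.unitsPerm_apply_eq (χ g) y

/-- The units reading is the TRIVIAL homomorphism `Γ →* Perm |𝒴_{F,E}|`, whatever `χ`. [folklore] -/
theorem unitsAct_eq_one : D.unitsAct χ = 1 := by
  ext g y
  rw [unitsAct_apply, MonoidHom.one_apply, Equiv.Perm.one_apply]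

/-- The units reading commutes with the Frobenius `φ` (so it passes to `|𝒳_{F,E}| = |𝒴_{F,E}|/φ^ℤ`). [folklore] -/
theorem unitsAct_frob (g : Γ) (y : D.Pt) : D.unitsAct χ g (D.frob y) = D.frob (D.unitsAct χ g y) := by
  rw [unitsAct_apply, unitsAct_apply]

/-- The units reading commutes with every `σ ∈ Aut_{𝒪_E}(𝒢(𝒪_F))` (Thm 5.21.1 (3), p429850 `ptAct`). [folklore] -/
theorem unitsAct_ptAct (g : Γ) (σ : D.Aut) (y : D.Pt) : D.unitsAct χ g (D.ptAct σ y) = D.ptAct σ (D.unitsAct χ g y) := by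
  rw [unitsAct_apply, unitsAct_apply]

/-- Each `g` acts CONTINUOUSLY for the constructed topology `ptTopology` (p443500) («topological group actions»). [folklore] -/
theorem continuous_unitsAct (g : Γ) : @Continuous _ _ D.ptTopology D.ptTopology (D.unitsAct χ g) := by
  have h : (D.unitsAct χ g : D.Pt → D.Pt) = id := funext (D.unitsAct_apply χ g)
  rw [h]
  exact @continuous_id _ D.ptTopology

/-! ## 2. E-t21's signature `ATS1.PointsTopGal` instantiated at the constructed topology -/

/-- **`ATS1.PointsTopGal E D` INSTANTIATED** (E-t21 p433841: «a topology on `|𝒴_{F,E}|` and the action of `G_E` … commuting with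
Frobenius»): topology := the CONSTRUCTED `ptTopology` (quotient of the subspace topology of `𝒢(𝒪_F) − {0}` along (5.20.2), p443500);
action := the units reading of `G_E = E.fixingSubgroup ≤ G_{ℚ_p}` through `χ : G_E → 𝒪_E^*`. [claim: Joshi2021ATS1, status: disputed] -/
@[claim "Joshi2021ATS1" "disputed"]
def pointsTopGalOfUnits (E : IntermediateField ℚ_[p] (AlgebraicClosure ℚ_[p])) (χ : ↥E.fixingSubgroup →* 𝒪Eˣ) :
    ATS1.PointsTopGal E D where
  top := D.ptTopology
  act := D.unitsAct χ
  act_frob g y := D.unitsAct_frob χ g y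

/-- The instantiated topology is the constructed one. [folklore] -/
theorem pointsTopGalOfUnits_top (E : IntermediateField ℚ_[p] (AlgebraicClosure ℚ_[p])) (χ : ↥E.fixingSubgroup →* 𝒪Eˣ) :
    (D.pointsTopGalOfUnits E χ).top = D.ptTopology := rfl

/-- The instantiated action fixes every point. [folklore] -/
theorem pointsTopGalOfUnits_act (E : IntermediateField ℚ_[p] (AlgebraicClosure ℚ_[p])) (χ : ↥E.fixingSubgroup →* 𝒪Eˣ)
    (g : ↥E.fixingSubgroup) (y : D.Pt) : (D.pointsTopGalOfUnits E χ).act g y = y := D.unitsAct_apply χ g y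

/-- E-t21's signature is INHABITED over every points-signature `D` and every base field `E` (e.g. `χ = 1`). [folklore] -/
theorem nonempty_pointsTopGal (E : IntermediateField ℚ_[p] (AlgebraicClosure ℚ_[p])) : Nonempty (ATS1.PointsTopGal E D) :=
  ⟨D.pointsTopGalOfUnits E 1⟩

end UntiltPoints

/-! ## 3. LOCATED: under the units reading the `G_E`-clause of Thm 5.20.1 is idle -/

namespace ATS1

variable {𝒪E 𝒪E' : Type} [CommRing 𝒪E] [CommRing 𝒪E'] {D : UntiltPoints p 𝒪E} {D' : UntiltPoints p 𝒪E'}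
  {E E' : IntermediateField ℚ_[p] (AlgebraicClosure ℚ_[p])}

/-- **LOCATED. Under units readings on both sides, E-t21's `Thm5201Full` (Thm 5.20.1, full printed form) is EQUIVALENT to the
Galois-free sentence** «every topological isomorphism `G_E ≃ G_{E′}` yields a Frobenius-compatible homeomorphism
`|𝒴_{F,E}| ≃ₜ |𝒴_{F,E′}|` for the constructed topologies»: the clause «compatible with the respective topological group actions»
(p.33 l.36–37) carries no content under this reading, because both actions are trivial on (5.20.2) (`unitsAct_apply`). A kernel
fact about the typed reading; whether print intends this reading is not adjudicated. [folklore] -/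
theorem thm5201Full_units_iff (χ : ↥E.fixingSubgroup →* 𝒪Eˣ) (χ' : ↥E'.fixingSubgroup →* 𝒪E'ˣ) :
    Thm5201Full E E' (D.pointsTopGalOfUnits E χ) (D'.pointsTopGalOfUnits E' χ') ↔
      ∀ _ : ↥E.fixingSubgroup ≃ₜ* ↥E'.fixingSubgroup,
        ∃ e : @Homeomorph D.Pt D'.Pt D.ptTopology D'.ptTopology, ∀ y, e (D.frob y) = D'.frob (e y) := by
  constructor
  · intro h α
    obtain ⟨e, he, -⟩ := h α
    exact ⟨e, he⟩
  · intro h α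
    obtain ⟨e, he⟩ := h α
    refine ⟨e, he, fun g y => ?_⟩
    show e (D.unitsAct χ g y) = D'.unitsAct χ' (α g) (e y)
    rw [D.unitsAct_apply, D'.unitsAct_apply]

/-- The truth value of `Thm5201Full` under units readings does NOT depend on the characters `χ, χ′`. [folklore] -/
theorem thm5201Full_units_indep (χ₁ χ₂ : ↥E.fixingSubgroup →* 𝒪Eˣ) (χ₁' χ₂' : ↥E'.fixingSubgroup →* 𝒪E'ˣ) :
    Thm5201Full E E' (D.pointsTopGalOfUnits E χ₁) (D'.pointsTopGalOfUnits E' χ₁') ↔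
      Thm5201Full E E' (D.pointsTopGalOfUnits E χ₂) (D'.pointsTopGalOfUnits E' χ₂') := by
  rw [thm5201Full_units_iff, thm5201Full_units_iff]

/-- **A single Frobenius-compatible homeomorphism of the constructed spaces gives Thm 5.20.1 (full form) under EVERY pair of units
readings** — the `G_E`-data add no obligation. [folklore] -/
theorem thm5201Full_units_of_frobHomeomorph (e : @Homeomorph D.Pt D'.Pt D.ptTopology D'.ptTopology)
    (he : ∀ y, e (D.frob y) = D'.frob (e y)) (χ : ↥E.fixingSubgroup →* 𝒪Eˣ) (χ' : ↥E'.fixingSubgroup →* 𝒪E'ˣ) :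
    Thm5201Full E E' (D.pointsTopGalOfUnits E χ) (D'.pointsTopGalOfUnits E' χ') :=
  (thm5201Full_units_iff χ χ').2 fun _ => ⟨e, he⟩

/-- **Non-vacuity of the claim's shape: the reflexive case HOLDS** (`E′ = E`, `D′ = D`, any two characters; `e = id`). A satisfiability
datum for E-t21's hypothesis `Thm5201Full`, nothing about the Fargues–Fontaine curve. [folklore] -/
theorem thm5201Full_units_self (χ χ' : ↥E.fixingSubgroup →* 𝒪Eˣ) :
    Thm5201Full E E (D.pointsTopGalOfUnits E χ) (D.pointsTopGalOfUnits E χ') :=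
  thm5201Full_units_of_frobHomeomorph (@Homeomorph.refl D.Pt D.ptTopology) (fun _ => rfl) χ χ'

/-- Under units readings, `Thm5201Full` yields E-t21's weak shell `Thm5201` (p431643: a Frobenius-compatible BIJECTION from an
isomorphism of Galois groups) for every TOPOLOGICAL isomorphism `G_E ≃ G_{E′}` — by name, via `exists_equiv_of_thm5201Full`. [folklore] -/
theorem exists_equiv_of_thm5201Full_units {χ : ↥E.fixingSubgroup →* 𝒪Eˣ} {χ' : ↥E'.fixingSubgroup →* 𝒪E'ˣ}
    (h : Thm5201Full E E' (D.pointsTopGalOfUnits E χ) (D'.pointsTopGalOfUnits E' χ'))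
    (α : ↥E.fixingSubgroup ≃ₜ* ↥E'.fixingSubgroup) :
    ∃ e : D.Pt ≃ D'.Pt, (∀ y, e (D.frob y) = D'.frob (e y)) ∧ Nonempty (D.XPoints ≃ D'.XPoints) :=
  exists_equiv_of_thm5201Full h α

end ATS1

end Summit.ABC.IUTFork.Joshi

end
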